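import Literature.MathematicalPhysics.QuantumFieldTheory.Balaban1983to89.UnitaryModel

/-!
# SUBSTRATE — BACKGROUND FIELDS OF RECORD: existence of Bałaban's constrained Wilson minimisers `U_k(V)` by compactness
# in the vocabulary of record (`Setup.IsBackground`), and the `Setup.Background` DATA instance by choice

Cell `pub-balaban`, SUBSTRATE cell (coordinator + user 2026-08-20), seat `b2b-balaban-substrate-p2`; registry item S-BG (existence)
of `substrate/STATUS.md` §2 ∕ typer sketch `substrate/typer/SubstrateSketch.v0.1.lean` §D2 (`MinimiserExists_stmt`, `reachable`,
`backgroundOfRecord`).  Summits-side, under the LEAN PLACEMENT RULE (cell modelling + bookkeeping; NOT a Literature module); imports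
`Setup` (through `UnitaryModel`, for the `U(n)` ∕ `SU(n)` non-vacuity) and edits nothing.

HONEST FRAMING (T4-DAG p. 1).  Rung (B)+1 of the FINITE-VOLUME T⁴ continuum programme — NOT infinite volume, NOT a mass gap, NOT the
Clay problem, NOT summit progress.  What is proved is the EXTREME-VALUE THEOREM on a finite product of a compact group: the constrained
Wilson action attains its minimum on a closed class.  This is the EXISTENCE half of the TYPE of [Balaban1985Variational] Thm 1 p. 279
(*"there exists exactly one orbit [of minimal configurations] …"*) for the cell's `Setup.IsBackground` — with NO regularity ((9)–(10)
of Thm 1), NO uniqueness modulo gauge, NO bound on `N, k`, nothing printed asserted; row NE3's leaf A-H1 has the V3-vocabulary twin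
`MinimalActionExistence.exists_isMinimiser_of_nonempty` (p212157), this is the V1 (`Setup`) twin the substrate's two-run object
(`SubstrateTwoRunsDriven.DrivenRuns.bgA ∕ bgB`, p217182) and NE7's NODE O.3 («minimisers `UA UB`») instantiate.  HONEST DEPENDENCY
(cell line, verbatim): continuum YM on T⁴ ⇐ BetaPertH ∧ nine spine estimates (0/9 proved); BetaPertH ⇐ (D1) ∧ (D4) ∧ CAP+tail;
G-an2-4 gates asym, D1 and NE2/3/4.

WHAT THIS FILE DOES.
* §1 TOPOLOGY OF RECORD on `GaugeField P j G = (PBond P j → G)`: the product topology (instance), compactness from a compact `G`,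
  Hausdorffness from a Hausdorff `G`; continuity of bond evaluation, of the plaquette variables `plaqHol` (topological group), of the
  Wilson actions `wilsonAction w` ∕ `wilsonAction4` (given `Continuous reTr`), and of the iterated averaging `Averaging.iter av k`
  (given each one-step averaging continuous).
* §2 THE CONSTRAINT SURFACE: `reachable av reg k` (level-`k` fields `M^k(U)` of regular `U`, typer's name), `constraintSet av reg k V =
  reg ∩ {U | M^k U = V}`, closed (Hausdorff `G`) hence compact (compact `G`).
* §3 **`exists_isBackground`** — the sketch's `MinimiserExists_stmt` AS A THEOREM, WITH ONE ADDED HYPOTHESIS `[T2Space G]`: compact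
  Hausdorff topological group `G`, continuous `reTr`, continuous averagings, closed class `reg`, `V` reachable ⇒ `∃ U₀, IsBackground av
  reg k V U₀` (`IsCompact.exists_isMinOn`).  TYPER NOTE: without a separation axiom on `G` the sketch's statement is not provable by
  this route (the fibre `{U | M^k U = V}` need not be closed; for a non-T₀ compact group and an out-of-range level, where
  `Setup.Averaging` is unconstrained, it fails) — `U(n)`, `SU(n)` are Hausdorff, so nothing of use is lost.
* §4 **`backgroundOfRecord av reg h : Setup.Background P G av`** (typer's §D2 verbatim: domain = `reachable`, `U k V` = a chosen
  minimiser, junk `1` off the domain) and **`backgroundOfRecordCompact`** (the existence witness supplied by §3); field lemmas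
  `backgroundOfRecord_reg ∕ _dom`, `iter_backgroundOfRecord_U`, `backgroundOfRecord_U_mem`, `wilsonAction4_backgroundOfRecord_U_le`.
* §5 NON-VACUITY of the hypotheses: `U(n)` and `SU(n)` (the tree's `GaugeGroup` instances of `UnitaryModel`) are compact Hausdorff
  topological groups with continuous `reTr` (`continuous_reTr_unitaryGroup`, `continuous_reTr_specialUnitaryGroup`), so
  `exists_isBackground_specialUnitaryGroup` needs only continuous averagings, a closed class and reachability.
* §6 (v1.1 — THE FORM CONSUMED AT THE ℰ OF RECORD, R-ne9leaf07g8-1): §1–§5's global continuity holds at the axial average only;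
  **`exists_isBackground_of_continuousOn`**, **`backgroundOfRecordOn`** need `ContinuousOn (M^k) reg` (cf. `SubstrateBlockAvgContinuity`).
No estimate, no `def … : Prop`, no `sorry`.
References (TYPE ∕ locus only): T. Bałaban, *The variational problem and background fields in renormalization group method for lattice
gauge theories*, Commun. Math. Phys. **102** (1985) 277–309 [Balaban1985Variational] Thm 1 p. 279; *Renormalization group approach to
lattice gauge field theories. I*, Commun. Math. Phys. **109** (1987) [Balaban1987RG1] (0.21) p. 256 («U_k(V) … the minimum of the action
… on the set of all U such that Ū^k = V»).
-/

noncomputable section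

open scoped BigOperators Topology

namespace Summit.QuantumFields.BalabanUV.T4Continuum.SubstrateBackground

open Literature.MathematicalPhysics.QuantumFieldTheory.Balaban1983to89

variable {P : Params} {G : Type*}

/-! ## §1 Topology of record on gauge fields; continuity of the Wilson action and of the averagings -/

/-- [folklore] THE TOPOLOGY OF RECORD on `GaugeField P j G = (PBond P j → G)`: the product topology. -/
instance instTopologicalSpaceGaugeField [TopologicalSpace G] {j : ℕ} : TopologicalSpace (GaugeField P j G) :=
  inferInstanceAs (TopologicalSpace (PBond P j → G))

/-- [folklore] A finite product of a compact group is compact. -/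
instance instCompactSpaceGaugeField [TopologicalSpace G] [CompactSpace G] {j : ℕ} : CompactSpace (GaugeField P j G) :=
  inferInstanceAs (CompactSpace (PBond P j → G))

/-- [folklore] A product of Hausdorff spaces is Hausdorff. -/
instance instT2SpaceGaugeField [TopologicalSpace G] [T2Space G] {j : ℕ} : T2Space (GaugeField P j G) :=
  inferInstanceAs (T2Space (PBond P j → G))

/-- [folklore] Bond evaluation `U ↦ U(b)` is continuous. -/
theorem continuous_eval [TopologicalSpace G] {j : ℕ} (b : PBond P j) : Continuous fun U : GaugeField P j G => U b :=
  (continuous_apply b : Continuous fun U : PBond P j → G => U b)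

/-- [folklore] A gauge-field-valued map is continuous iff all its bond components are. -/
theorem continuous_of_eval [TopologicalSpace G] {j : ℕ} {X : Type*} [TopologicalSpace X] {f : X → GaugeField P j G}
    (h : ∀ b : PBond P j, Continuous fun x => f x b) : Continuous f :=
  (continuous_pi h : Continuous (fun x => (f x : PBond P j → G)))

variable [GaugeGroup G]

/-- [folklore] The plaquette variable `U ↦ U(∂p)` is continuous (products and inverses in a topological group). -/
theorem continuous_plaqHol [TopologicalSpace G] [IsTopologicalGroup G] {j : ℕ} (p : Plaq P j) :
    Continuous fun U : GaugeField P j G => GaugeField.plaqHol U p := by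
  unfold GaugeField.plaqHol
  exact (((continuous_eval _).mul (continuous_eval _)).mul (continuous_eval _).inv).mul (continuous_eval _).inv

/-- [folklore] The weighted Wilson action `A^w(U) = Σ_p w·(1 − Re tr U(∂p))` is continuous when `Re tr` is. -/
theorem continuous_wilsonAction [TopologicalSpace G] [IsTopologicalGroup G] {j : ℕ} (hreTr : Continuous (reTr : G → ℝ))
    (w : ℝ) : Continuous (wilsonAction (P := P) (j := j) (G := G) w) := by
  unfold wilsonAction
  exact continuous_finsetSum _ fun p _ =>
    continuous_const.mul (continuous_const.sub (hreTr.comp (continuous_plaqHol p)))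

/-- [folklore] The `d = 4` Wilson action is continuous when `Re tr` is. -/
theorem continuous_wilsonAction4 [TopologicalSpace G] [IsTopologicalGroup G] {j : ℕ} (hreTr : Continuous (reTr : G → ℝ)) :
    Continuous (wilsonAction4 (P := P) (j := j) (G := G)) :=
  continuous_wilsonAction hreTr 1

/-- [folklore] The `k`-fold averaging `M^k = Averaging.iter av k` is continuous when every one-step averaging is. -/
theorem continuous_iter [TopologicalSpace G] (av : ∀ j, Averaging P j G) (hav : ∀ j, Continuous (av j).avg) :
    ∀ k : ℕ, Continuous (Averaging.iter av k)
  | 0 => continuous_id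
  | k + 1 => (hav k).comp (continuous_iter av hav k)

/-! ## §2 The constraint surface -/

/-- [folklore] THE REACHABLE LEVEL-`k` FIELDS: averages `M^k(U)` of configurations `U` of the class `reg` (the natural domain of a
background-field assignment; typer's `reachable`). -/
def reachable (av : ∀ j, Averaging P j G) (reg : Set (GaugeField P 0 G)) (k : ℕ) : Set (GaugeField P k G) :=
  {V | ∃ U ∈ reg, Averaging.iter av k U = V}

/-- [folklore] Membership in `reachable`. -/
theorem mem_reachable {av : ∀ j, Averaging P j G} {reg : Set (GaugeField P 0 G)} {k : ℕ} {V : GaugeField P k G} :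
    V ∈ reachable av reg k ↔ ∃ U ∈ reg, Averaging.iter av k U = V := Iff.rfl

/-- [folklore] THE CONSTRAINT SET over `V`: configurations of the class averaging to `V` in `k` steps ([Balaban1987RG1] (0.21):
«the set of all U such that Ū^k = V», intersected with the regular class). -/
def constraintSet (av : ∀ j, Averaging P j G) (reg : Set (GaugeField P 0 G)) (k : ℕ) (V : GaugeField P k G) :
    Set (GaugeField P 0 G) :=
  {U | U ∈ reg ∧ Averaging.iter av k U = V}

/-- [folklore] Membership in the constraint set. -/
theorem mem_constraintSet {av : ∀ j, Averaging P j G} {reg : Set (GaugeField P 0 G)} {k : ℕ} {V : GaugeField P k G}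
    {U : GaugeField P 0 G} : U ∈ constraintSet av reg k V ↔ U ∈ reg ∧ Averaging.iter av k U = V := Iff.rfl

/-- [folklore] `V` is reachable iff its constraint set is non-empty. -/
theorem constraintSet_nonempty_iff {av : ∀ j, Averaging P j G} {reg : Set (GaugeField P 0 G)} {k : ℕ} {V : GaugeField P k G} :
    (constraintSet av reg k V).Nonempty ↔ V ∈ reachable av reg k :=
  ⟨fun ⟨U, hU, hUV⟩ => ⟨U, hU, hUV⟩, fun ⟨U, hU, hUV⟩ => ⟨U, hU, hUV⟩⟩

/-- [folklore] `IsBackground` unfolded against the constraint set: a member of the constraint set minimising the Wilson action on it. -/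
theorem isBackground_iff {av : ∀ j, Averaging P j G} {reg : Set (GaugeField P 0 G)} {k : ℕ} {V : GaugeField P k G}
    {U₀ : GaugeField P 0 G} :
    IsBackground av reg k V U₀ ↔ U₀ ∈ constraintSet av reg k V ∧ ∀ U ∈ constraintSet av reg k V, wilsonAction4 U₀ ≤ wilsonAction4 U := by
  constructor
  · rintro ⟨hV, hreg, hmin⟩
    exact ⟨⟨hreg, hV⟩, fun U hU => hmin U hU.1 hU.2⟩
  · rintro ⟨⟨hreg, hV⟩, hmin⟩
    exact ⟨hV, hreg, fun U hU hUV => hmin U ⟨hU, hUV⟩⟩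

/-- [folklore] Over a Hausdorff group with continuous averagings, the constraint set of a CLOSED class is closed. -/
theorem isClosed_constraintSet [TopologicalSpace G] [T2Space G] (av : ∀ j, Averaging P j G) (hav : ∀ j, Continuous (av j).avg)
    {reg : Set (GaugeField P 0 G)} (hreg : IsClosed reg) (k : ℕ) (V : GaugeField P k G) :
    IsClosed (constraintSet av reg k V) :=
  hreg.inter (isClosed_eq (continuous_iter av hav k) continuous_const)

/-- [folklore] Over a compact Hausdorff group the constraint set of a closed class is compact. -/
theorem isCompact_constraintSet [TopologicalSpace G] [T2Space G] [CompactSpace G] (av : ∀ j, Averaging P j G)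
    (hav : ∀ j, Continuous (av j).avg) {reg : Set (GaugeField P 0 G)} (hreg : IsClosed reg) (k : ℕ) (V : GaugeField P k G) :
    IsCompact (constraintSet av reg k V) :=
  (isClosed_constraintSet av hav hreg k V).isCompact

/-! ## §3 Existence of background fields (the extreme-value theorem) -/

/-- [folklore] **EXISTENCE OF BAŁABAN's CONSTRAINED MINIMISERS IN THE VOCABULARY OF RECORD** (typer's `MinimiserExists_stmt` as a
theorem, with the separation hypothesis `[T2Space G]` added — see the module docstring): on a compact Hausdorff topological group with
continuous `Re tr` and continuous one-step averagings, for a closed class `reg` and a reachable `V` the Wilson action attains its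
minimum on the constraint set, i.e. `∃ U₀, IsBackground av reg k V U₀`.  The EXISTENCE half of the TYPE of [Balaban1985Variational]
Thm 1 (no regularity, no uniqueness; nothing printed asserted). -/
theorem exists_isBackground [TopologicalSpace G] [IsTopologicalGroup G] [CompactSpace G] [T2Space G]
    (hreTr : Continuous (reTr : G → ℝ)) (av : ∀ j, Averaging P j G) (hav : ∀ j, Continuous (av j).avg)
    {reg : Set (GaugeField P 0 G)} (hreg : IsClosed reg) (k : ℕ) {V : GaugeField P k G} (hV : V ∈ reachable av reg k) :
    ∃ U₀, IsBackground av reg k V U₀ := by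
  obtain ⟨U₀, hU₀, hmin⟩ := (isCompact_constraintSet av hav hreg k V).exists_isMinOn (constraintSet_nonempty_iff.2 hV)
    (continuous_wilsonAction4 hreTr).continuousOn
  exact ⟨U₀, isBackground_iff.2 ⟨hU₀, fun U hU => hmin hU⟩⟩

/-- [folklore] The same on the whole reachable domain, in the shape `backgroundOfRecord` consumes. -/
theorem forall_exists_isBackground [TopologicalSpace G] [IsTopologicalGroup G] [CompactSpace G] [T2Space G]
    (hreTr : Continuous (reTr : G → ℝ)) (av : ∀ j, Averaging P j G) (hav : ∀ j, Continuous (av j).avg)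
    {reg : Set (GaugeField P 0 G)} (hreg : IsClosed reg) :
    ∀ (k : ℕ) (V : GaugeField P k G), V ∈ reachable av reg k → ∃ U₀, IsBackground av reg k V U₀ :=
  fun k _ hV => exists_isBackground hreTr av hav hreg k hV

/-! ## §4 The `Setup.Background` data of record (by choice) -/

open Classical in
/-- [folklore] **THE BACKGROUND OF RECORD** (typer's §D2, data by choice): from ANY existence witness `h` on the reachable domain,
the assignment `V ↦ U_k(V)` := a chosen minimiser (junk value `1` off the domain), packaged as `Setup.Background P G av` with
`reg := reg`, `dom := reachable av reg`. -/
def backgroundOfRecord (av : ∀ j, Averaging P j G) (reg : Set (GaugeField P 0 G))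
    (h : ∀ (k : ℕ) (V : GaugeField P k G), V ∈ reachable av reg k → ∃ U₀, IsBackground av reg k V U₀) : Background P G av where
  reg := reg
  dom := reachable av reg
  U := fun k V => if hV : V ∈ reachable av reg k then (h k V hV).choose else 1
  isBackground := fun k V hV => by
    simp only [dif_pos hV]
    exact (h k V hV).choose_spec

/-- [folklore] The class of the background of record is `reg` (`rfl`). -/
@[simp] theorem backgroundOfRecord_reg (av : ∀ j, Averaging P j G) (reg : Set (GaugeField P 0 G))
    (h : ∀ (k : ℕ) (V : GaugeField P k G), V ∈ reachable av reg k → ∃ U₀, IsBackground av reg k V U₀) :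
    (backgroundOfRecord av reg h).reg = reg := rfl

/-- [folklore] The domain of the background of record is the reachable set (`rfl`). -/
@[simp] theorem backgroundOfRecord_dom (av : ∀ j, Averaging P j G) (reg : Set (GaugeField P 0 G))
    (h : ∀ (k : ℕ) (V : GaugeField P k G), V ∈ reachable av reg k → ∃ U₀, IsBackground av reg k V U₀) (k : ℕ) :
    (backgroundOfRecord av reg h).dom k = reachable av reg k := rfl

/-- [folklore] On the domain, the background of record IS a background (`Background.isBackground` by name). -/
theorem isBackground_backgroundOfRecord (av : ∀ j, Averaging P j G) (reg : Set (GaugeField P 0 G))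
    (h : ∀ (k : ℕ) (V : GaugeField P k G), V ∈ reachable av reg k → ∃ U₀, IsBackground av reg k V U₀) {k : ℕ}
    {V : GaugeField P k G} (hV : V ∈ reachable av reg k) :
    IsBackground av reg k V ((backgroundOfRecord av reg h).U k V) :=
  (backgroundOfRecord av reg h).isBackground k V hV

/-- [folklore] The constraint: `M^k(U_k(V)) = V` on the domain. -/
theorem iter_backgroundOfRecord_U (av : ∀ j, Averaging P j G) (reg : Set (GaugeField P 0 G))
    (h : ∀ (k : ℕ) (V : GaugeField P k G), V ∈ reachable av reg k → ∃ U₀, IsBackground av reg k V U₀) {k : ℕ}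
    {V : GaugeField P k G} (hV : V ∈ reachable av reg k) :
    Averaging.iter av k ((backgroundOfRecord av reg h).U k V) = V :=
  (isBackground_backgroundOfRecord av reg h hV).1

/-- [folklore] Regularity: `U_k(V) ∈ reg` on the domain. -/
theorem backgroundOfRecord_U_mem (av : ∀ j, Averaging P j G) (reg : Set (GaugeField P 0 G))
    (h : ∀ (k : ℕ) (V : GaugeField P k G), V ∈ reachable av reg k → ∃ U₀, IsBackground av reg k V U₀) {k : ℕ}
    {V : GaugeField P k G} (hV : V ∈ reachable av reg k) :
    (backgroundOfRecord av reg h).U k V ∈ reg :=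
  (isBackground_backgroundOfRecord av reg h hV).2.1

/-- [folklore] Minimality: `A(U_k(V)) ≤ A(U)` for every regular `U` with `M^k(U) = V`. -/
theorem wilsonAction4_backgroundOfRecord_U_le (av : ∀ j, Averaging P j G) (reg : Set (GaugeField P 0 G))
    (h : ∀ (k : ℕ) (V : GaugeField P k G), V ∈ reachable av reg k → ∃ U₀, IsBackground av reg k V U₀) {k : ℕ}
    {V : GaugeField P k G} (hV : V ∈ reachable av reg k) {U : GaugeField P 0 G} (hU : U ∈ reg)
    (hUV : Averaging.iter av k U = V) :
    wilsonAction4 ((backgroundOfRecord av reg h).U k V) ≤ wilsonAction4 U :=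
  (isBackground_backgroundOfRecord av reg h hV).2.2 U hU hUV

/-- [folklore] Off the domain the background of record is the junk value `1`. -/
theorem backgroundOfRecord_U_of_not_mem (av : ∀ j, Averaging P j G) (reg : Set (GaugeField P 0 G))
    (h : ∀ (k : ℕ) (V : GaugeField P k G), V ∈ reachable av reg k → ∃ U₀, IsBackground av reg k V U₀) {k : ℕ}
    {V : GaugeField P k G} (hV : V ∉ reachable av reg k) :
    (backgroundOfRecord av reg h).U k V = 1 := by
  classical
  show (if hV : V ∈ reachable av reg k then (h k V hV).choose else 1) = 1
  rw [dif_neg hV]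

/-- [folklore] **THE BACKGROUND OF RECORD FROM COMPACTNESS**: on a compact Hausdorff group with continuous `Re tr`, continuous
averagings and a closed class, §3 supplies the existence witness — no hypothesis on Bałaban's objects remains besides the choice of
`av` and `reg`. -/
def backgroundOfRecordCompact [TopologicalSpace G] [IsTopologicalGroup G] [CompactSpace G] [T2Space G]
    (hreTr : Continuous (reTr : G → ℝ)) (av : ∀ j, Averaging P j G) (hav : ∀ j, Continuous (av j).avg)
    (reg : Set (GaugeField P 0 G)) (hreg : IsClosed reg) : Background P G av :=
  backgroundOfRecord av reg (forall_exists_isBackground hreTr av hav hreg)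

/-- [folklore] The compactness background's domain is the reachable set (`rfl`). -/
@[simp] theorem backgroundOfRecordCompact_dom [TopologicalSpace G] [IsTopologicalGroup G] [CompactSpace G] [T2Space G]
    (hreTr : Continuous (reTr : G → ℝ)) (av : ∀ j, Averaging P j G) (hav : ∀ j, Continuous (av j).avg)
    (reg : Set (GaugeField P 0 G)) (hreg : IsClosed reg) (k : ℕ) :
    (backgroundOfRecordCompact hreTr av hav reg hreg).dom k = reachable av reg k := rfl

/-- [folklore] The compactness background's class is `reg` (`rfl`). -/
@[simp] theorem backgroundOfRecordCompact_reg [TopologicalSpace G] [IsTopologicalGroup G] [CompactSpace G] [T2Space G]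
    (hreTr : Continuous (reTr : G → ℝ)) (av : ∀ j, Averaging P j G) (hav : ∀ j, Continuous (av j).avg)
    (reg : Set (GaugeField P 0 G)) (hreg : IsClosed reg) :
    (backgroundOfRecordCompact hreTr av hav reg hreg).reg = reg := rfl

/-- [folklore] Every regular configuration's `k`-fold average is in the domain of the background of record (the domain is as large
as it can be). -/
theorem iter_mem_reachable (av : ∀ j, Averaging P j G) {reg : Set (GaugeField P 0 G)} {U : GaugeField P 0 G} (hU : U ∈ reg)
    (k : ℕ) : Averaging.iter av k U ∈ reachable av reg k :=
  ⟨U, hU, rfl⟩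

/-! ## §5 Non-vacuity of the hypotheses: `U(n)` and `SU(n)` -/

section Unitary

variable {n : Type*} [DecidableEq n] [Fintype n] [Nonempty n]

/-- [folklore] On `U(n)` (the tree's `GaugeGroup` instance `instGaugeGroupUnitaryGroup`: `reTr U = Re Tr U / n`) `Re tr` is continuous. -/
theorem continuous_reTr_unitaryGroup : Continuous (reTr : Matrix.unitaryGroup n ℂ → ℝ) :=
  UnitaryModel.continuous_nReTr.comp (Literature.MathematicalPhysics.QuantumLattice.continuous_unitaryFundamentalRep n ℂ)

/-- [folklore] On `SU(n)` (`instGaugeGroupSpecialUnitaryGroup`) `Re tr` is continuous. -/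
theorem continuous_reTr_specialUnitaryGroup : Continuous (reTr : Matrix.specialUnitaryGroup n ℂ → ℝ) :=
  UnitaryModel.continuous_nReTr.comp (Literature.MathematicalPhysics.QuantumLattice.continuous_fundamentalRep n)

/-- [folklore] **BACKGROUND FIELDS EXIST FOR `SU(n)`**: for continuous averagings, a closed class and a reachable `V` — the group-side
hypotheses of `exists_isBackground` (compact, Hausdorff, topological group, continuous `Re tr`) are all instances ∕ theorems of the
tree for `Matrix.specialUnitaryGroup n ℂ`. -/
theorem exists_isBackground_specialUnitaryGroup (av : ∀ j, Averaging P j (Matrix.specialUnitaryGroup n ℂ))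
    (hav : ∀ j, Continuous (av j).avg) {reg : Set (GaugeField P 0 (Matrix.specialUnitaryGroup n ℂ))} (hreg : IsClosed reg)
    (k : ℕ) {V : GaugeField P k (Matrix.specialUnitaryGroup n ℂ)} (hV : V ∈ reachable av reg k) :
    ∃ U₀, IsBackground av reg k V U₀ :=
  exists_isBackground continuous_reTr_specialUnitaryGroup av hav hreg k hV

/-- [folklore] The same for `U(n)`. -/
theorem exists_isBackground_unitaryGroup (av : ∀ j, Averaging P j (Matrix.unitaryGroup n ℂ))
    (hav : ∀ j, Continuous (av j).avg) {reg : Set (GaugeField P 0 (Matrix.unitaryGroup n ℂ))} (hreg : IsClosed reg)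
    (k : ℕ) {V : GaugeField P k (Matrix.unitaryGroup n ℂ)} (hV : V ∈ reachable av reg k) :
    ∃ U₀, IsBackground av reg k V U₀ :=
  exists_isBackground continuous_reTr_unitaryGroup av hav hreg k hV

end Unitary

/-! ## §6 (v1.1, appended) Existence with continuity ON THE CLASS only — repair of the located type remark R-ne9leaf07g8-1
(ne9-formalise-leaf-07-g8, journal l.13634) ∕ typer finding F-SUB-T1 (MAP v0.4 §O1 D-3″, sketch v0.4 §BG2)

The global hypothesis `hav : ∀ j, Continuous (av j).avg` of §2–§4 holds for the axial ∕ trivial-loop-average object but is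
UNSATISFIABLE at the small-loop average of record `ExpMeanLog.expMeanLogU ∕ expMeanLogSU` (its guard `BlockAveraging.corr` jumps across
`dist1 = δ`).  What the extreme-value argument actually uses is continuity of the `k`-fold averaging `M^k` ON the closed class `reg`
(Bałaban's small-field classes: `SubstrateBlockAvgContinuity`); §2–§4 = the special case `continuousOn_iter_of_continuous`. -/

section OnClass

/-- [folklore] The constraint set is the class cut by a fibre of `M^k`: `reg ∩ (M^k)⁻¹{V}`. -/
theorem constraintSet_eq_inter_preimage (av : ∀ j, Averaging P j G) (reg : Set (GaugeField P 0 G)) (k : ℕ) (V : GaugeField P k G) :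
    constraintSet av reg k V = reg ∩ Averaging.iter av k ⁻¹' {V} := rfl

/-- [folklore] **CLOSED CONSTRAINT SETS FROM CONTINUITY ON THE CLASS** (sketch v0.4 `IsClosedConstraintSetOn_stmt`): on a Hausdorff group,
a closed class on which `M^k` is continuous has closed constraint sets (`ContinuousOn.preimage_isClosed_of_isClosed`). -/
theorem isClosed_constraintSet_of_continuousOn [TopologicalSpace G] [T2Space G] (av : ∀ j, Averaging P j G)
    {reg : Set (GaugeField P 0 G)} (hreg : IsClosed reg) {k : ℕ} (hiter : ContinuousOn (Averaging.iter av k) reg)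
    (V : GaugeField P k G) : IsClosed (constraintSet av reg k V) := by
  rw [constraintSet_eq_inter_preimage]
  exact hiter.preimage_isClosed_of_isClosed hreg isClosed_singleton

/-- [folklore] Hence compact over a compact Hausdorff group. -/
theorem isCompact_constraintSet_of_continuousOn [TopologicalSpace G] [T2Space G] [CompactSpace G] (av : ∀ j, Averaging P j G)
    {reg : Set (GaugeField P 0 G)} (hreg : IsClosed reg) {k : ℕ} (hiter : ContinuousOn (Averaging.iter av k) reg)
    (V : GaugeField P k G) : IsCompact (constraintSet av reg k V) :=
  (isClosed_constraintSet_of_continuousOn av hreg hiter V).isCompact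

/-- [folklore] **EXISTENCE OF CONSTRAINED MINIMISERS, CONTINUITY ON THE CLASS ONLY** (sketch v0.4 `MinimiserExistsOn_stmt` as a
theorem): compact Hausdorff `G`, continuous `Re tr`, a closed class on which `M^k` is continuous, `V` reachable ⇒
`∃ U₀, IsBackground av reg k V U₀`.  The EXISTENCE half of the TYPE of [Balaban1985Variational] Thm 1 (nothing printed asserted). -/
theorem exists_isBackground_of_continuousOn [TopologicalSpace G] [IsTopologicalGroup G] [CompactSpace G] [T2Space G]
    (hreTr : Continuous (reTr : G → ℝ)) (av : ∀ j, Averaging P j G) {reg : Set (GaugeField P 0 G)} (hreg : IsClosed reg) {k : ℕ}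
    (hiter : ContinuousOn (Averaging.iter av k) reg) {V : GaugeField P k G} (hV : V ∈ reachable av reg k) :
    ∃ U₀, IsBackground av reg k V U₀ := by
  obtain ⟨U₀, hU₀, hmin⟩ := (isCompact_constraintSet_of_continuousOn av hreg hiter V).exists_isMinOn
    (constraintSet_nonempty_iff.2 hV) (continuous_wilsonAction4 hreTr).continuousOn
  exact ⟨U₀, isBackground_iff.2 ⟨hU₀, fun U hU => hmin hU⟩⟩

/-- [folklore] The same on the whole reachable domain, in the shape `backgroundOfRecord` consumes (`hiter` at every `k`). -/
theorem forall_exists_isBackground_of_continuousOn [TopologicalSpace G] [IsTopologicalGroup G] [CompactSpace G] [T2Space G]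
    (hreTr : Continuous (reTr : G → ℝ)) (av : ∀ j, Averaging P j G) {reg : Set (GaugeField P 0 G)} (hreg : IsClosed reg)
    (hiter : ∀ k, ContinuousOn (Averaging.iter av k) reg) :
    ∀ (k : ℕ) (V : GaugeField P k G), V ∈ reachable av reg k → ∃ U₀, IsBackground av reg k V U₀ :=
  fun k _ hV => exists_isBackground_of_continuousOn hreTr av hreg (hiter k) hV

/-- [folklore] **THE BACKGROUND OF RECORD FROM COMPACTNESS, CONTINUITY ON THE CLASS ONLY** — the `Setup.Background` the O-1 object
consumes at the small-loop average of record. -/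
def backgroundOfRecordOn [TopologicalSpace G] [IsTopologicalGroup G] [CompactSpace G] [T2Space G]
    (hreTr : Continuous (reTr : G → ℝ)) (av : ∀ j, Averaging P j G) (reg : Set (GaugeField P 0 G)) (hreg : IsClosed reg)
    (hiter : ∀ k, ContinuousOn (Averaging.iter av k) reg) : Background P G av :=
  backgroundOfRecord av reg (forall_exists_isBackground_of_continuousOn hreTr av hreg hiter)

/-- [folklore] Its domain is the reachable set (`rfl`). -/
@[simp] theorem backgroundOfRecordOn_dom [TopologicalSpace G] [IsTopologicalGroup G] [CompactSpace G] [T2Space G]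
    (hreTr : Continuous (reTr : G → ℝ)) (av : ∀ j, Averaging P j G) (reg : Set (GaugeField P 0 G)) (hreg : IsClosed reg)
    (hiter : ∀ k, ContinuousOn (Averaging.iter av k) reg) (k : ℕ) :
    (backgroundOfRecordOn hreTr av reg hreg hiter).dom k = reachable av reg k := rfl

/-- [folklore] Its class is `reg` (`rfl`). -/
@[simp] theorem backgroundOfRecordOn_reg [TopologicalSpace G] [IsTopologicalGroup G] [CompactSpace G] [T2Space G]
    (hreTr : Continuous (reTr : G → ℝ)) (av : ∀ j, Averaging P j G) (reg : Set (GaugeField P 0 G)) (hreg : IsClosed reg)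
    (hiter : ∀ k, ContinuousOn (Averaging.iter av k) reg) :
    (backgroundOfRecordOn hreTr av reg hreg hiter).reg = reg := rfl

/-- [folklore] On the domain it IS a background. -/
theorem isBackground_backgroundOfRecordOn [TopologicalSpace G] [IsTopologicalGroup G] [CompactSpace G] [T2Space G]
    (hreTr : Continuous (reTr : G → ℝ)) (av : ∀ j, Averaging P j G) (reg : Set (GaugeField P 0 G)) (hreg : IsClosed reg)
    (hiter : ∀ k, ContinuousOn (Averaging.iter av k) reg) {k : ℕ} {V : GaugeField P k G} (hV : V ∈ reachable av reg k) :
    IsBackground av reg k V ((backgroundOfRecordOn hreTr av reg hreg hiter).U k V) :=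
  isBackground_backgroundOfRecord av reg _ hV

/-- [folklore] The §2–§4 hypothesis is the special case: globally continuous one-step averagings give `M^k` continuous on every class. -/
theorem continuousOn_iter_of_continuous [TopologicalSpace G] (av : ∀ j, Averaging P j G) (hav : ∀ j, Continuous (av j).avg)
    (reg : Set (GaugeField P 0 G)) (k : ℕ) : ContinuousOn (Averaging.iter av k) reg :=
  (continuous_iter av hav k).continuousOn

end OnClass
section UnitaryOn

variable {n : Type*} [DecidableEq n] [Fintype n] [Nonempty n]

/-- [folklore] **`SU(n)`, continuity on the class**: constrained Wilson minimisers exist for every closed class on which `M^k` is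
continuous and every reachable `V`. -/
theorem exists_isBackground_specialUnitaryGroup_of_continuousOn (av : ∀ j, Averaging P j (Matrix.specialUnitaryGroup n ℂ))
    {reg : Set (GaugeField P 0 (Matrix.specialUnitaryGroup n ℂ))} (hreg : IsClosed reg) {k : ℕ}
    (hiter : ContinuousOn (Averaging.iter av k) reg) {V : GaugeField P k (Matrix.specialUnitaryGroup n ℂ)}
    (hV : V ∈ reachable av reg k) : ∃ U₀, IsBackground av reg k V U₀ :=
  exists_isBackground_of_continuousOn continuous_reTr_specialUnitaryGroup av hreg hiter hV

/-- [folklore] The same for `U(n)`. -/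
theorem exists_isBackground_unitaryGroup_of_continuousOn (av : ∀ j, Averaging P j (Matrix.unitaryGroup n ℂ))
    {reg : Set (GaugeField P 0 (Matrix.unitaryGroup n ℂ))} (hreg : IsClosed reg) {k : ℕ}
    (hiter : ContinuousOn (Averaging.iter av k) reg) {V : GaugeField P k (Matrix.unitaryGroup n ℂ)}
    (hV : V ∈ reachable av reg k) : ∃ U₀, IsBackground av reg k V U₀ :=
  exists_isBackground_of_continuousOn continuous_reTr_unitaryGroup av hreg hiter hV

end UnitaryOn
end Summit.QuantumFields.BalabanUV.T4Continuum.SubstrateBackground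

end
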